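import Summits.Schanuel.Schanuel.Theses.RoyCriterion
import Literature.NumberTheory.Transcendental.TubbsPeriodsIndependence
import Literature.Barriers.Schanuel.AlgebraicIndependenceOfLogarithms
import Literature.NumberTheory.Transcendental.TubbsPeriodsMain

/-!
# Schanuel / RoyCriterion — `SchanuelTwoOnPeriodLattices` (item `stmt-Schanuel-14661`)

Route `Schanuel/RoyCriterion`, support item `stmt-Schanuel-14661`, route declaration
`Summit.Schanuel.Schanuel.Theses.RoyCriterion.SchanuelTwoOnPeriodLattices`:
for every lattice basis `(ω₁, ω₂)` (Mathlib `PeriodPair`) with ALGEBRAIC invariants `g₂, g₃`,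
`trdeg_ℚ ℚ(ω₁, ω₂, e^{ω₁}, e^{ω₂}) ≥ 2` — Schanuel's conjecture in rank `2` at the point
`(ω₁, ω₂)`.

This file: the closure of the item MODULO the named fact
`Literature.NumberTheory.Transcendental.Tubbs1990_thm4_periods` (R. Tubbs, J. Number Theory 35
(1990), Thm 4 p. 112 + Remark p. 114, with `λ = 1`; = G. V. Chudnovsky, *Contributions* (1984),
Ch. 7 Thm 4.1 (i), p. 318): `trdeg_ℚ ℚ(g₂, g₃, ω₁, ω₂, 1, e^{ω₁}, e^{ω₂}) ≥ 2`, and adjoining the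
algebraic numbers `g₂, g₃` (and `1`) to `ℚ(ω₁, ω₂, e^{ω₁}, e^{ω₂})` does not change the
transcendence degree (`Literature.Barriers.Schanuel.trdeg_adjoin_union_eq_of_isAlgebraic`). The
result `schanuelTwoOnPeriodLattices_of_tubbs` is CONDITIONAL on that fact (hypothesis `h`); the
unconditional discharge is tracked on the item.
-/

-- single-conjunct summit: `Summit.Schanuel.Schanuel.…` is the mandated namespace (CONVENTIONS §1, D-0017)
set_option linter.dupNamespace false

noncomputable section

open Complex IntermediateField

namespace Summit.Schanuel.Schanuel.Theorems.RoyCriterion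

/-- `SchanuelTwoOnPeriodLattices` MODULO Tubbs 1990 Thm 4 (periods form, `λ = 1`): for a lattice
basis `(ω₁, ω₂)` with algebraic `g₂, g₃`, the field `ℚ(ω₁, ω₂, e^{ω₁}, e^{ω₂})(g₂, g₃, 1)` contains
`ℚ(g₂, g₃, ω₁, ω₂, 1, e^{1·ω₁}, e^{1·ω₂})`, which has `trdeg ≥ 2` by the fact (monotonicity of
`trdeg` along the inclusion), and adjoining the algebraic `g₂, g₃, 1` is `trdeg`-neutral
(`Literature.Barriers.Schanuel.trdeg_adjoin_union_eq_of_isAlgebraic`). CONDITIONAL on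
`Literature.NumberTheory.Transcendental.Tubbs1990_thm4_periods`.
[cite: Tubbs1990, Thm 4 p. 112 and Remark p. 114] -/
theorem schanuelTwoOnPeriodLattices_of_tubbs
    (h : Literature.NumberTheory.Transcendental.Tubbs1990_thm4_periods) :
    Summit.Schanuel.Schanuel.Theses.RoyCriterion.SchanuelTwoOnPeriodLattices := by
  unfold Summit.Schanuel.Schanuel.Theses.RoyCriterion.SchanuelTwoOnPeriodLattices
  intro L h₂ h₃
  set S : Set ℂ := Set.range ![L.ω₁, L.ω₂] ∪ Set.range (cexp ∘ ![L.ω₁, L.ω₂])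
  set T : Set ℂ := {L.g₂, L.g₃, (1 : ℂ)} with hT_def
  have hT : ∀ x ∈ T, IsAlgebraic ℚ x := by
    intro x hx
    simp only [hT_def, Set.mem_insert_iff, Set.mem_singleton_iff] at hx
    rcases hx with rfl | rfl | rfl
    exacts [h₂, h₃, isAlgebraic_one]
  have hsub : S ∪ T ⊆ (adjoin ℚ (S ∪ T) : Set ℂ) := subset_adjoin ℚ _
  have hg₂ : L.g₂ ∈ adjoin ℚ (S ∪ T) := hsub (Or.inr (by simp [hT_def]))
  have hg₃ : L.g₃ ∈ adjoin ℚ (S ∪ T) := hsub (Or.inr (by simp [hT_def]))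
  have h1 : (1 : ℂ) ∈ adjoin ℚ (S ∪ T) := one_mem _
  have hω₁ : L.ω₁ ∈ adjoin ℚ (S ∪ T) := hsub (Or.inl (Or.inl ⟨0, by simp⟩))
  have hω₂ : L.ω₂ ∈ adjoin ℚ (S ∪ T) := hsub (Or.inl (Or.inl ⟨1, by simp⟩))
  have he₁ : cexp (1 * L.ω₁) ∈ adjoin ℚ (S ∪ T) := by
    rw [one_mul]; exact hsub (Or.inl (Or.inr ⟨0, by simp⟩))
  have he₂ : cexp (1 * L.ω₂) ∈ adjoin ℚ (S ∪ T) := by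
    rw [one_mul]; exact hsub (Or.inl (Or.inr ⟨1, by simp⟩))
  have hF : adjoin ℚ ({L.g₂, L.g₃, L.ω₁, L.ω₂, (1 : ℂ), cexp (1 * L.ω₁), cexp (1 * L.ω₂)} : Set ℂ) ≤
      adjoin ℚ (S ∪ T) := by
    refine adjoin_le_iff.mpr ?_
    intro x hx
    simp only [Set.mem_insert_iff, Set.mem_singleton_iff] at hx
    rcases hx with rfl | rfl | rfl | rfl | rfl | rfl | rfl
    exacts [hg₂, hg₃, hω₁, hω₂, h1, he₁, he₂]
  calc (2 : Cardinal)
      ≤ Algebra.trdeg ℚ ↥(adjoin ℚ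
          ({L.g₂, L.g₃, L.ω₁, L.ω₂, (1 : ℂ), cexp (1 * L.ω₁), cexp (1 * L.ω₂)} : Set ℂ)) :=
        h L 1 one_ne_zero
    _ ≤ Algebra.trdeg ℚ ↥(adjoin ℚ (S ∪ T)) :=
        trdeg_le_of_injective (inclusion hF) (inclusion_injective hF)
    _ = Algebra.trdeg ℚ ↥(adjoin ℚ S) :=
        Literature.Barriers.Schanuel.trdeg_adjoin_union_eq_of_isAlgebraic S T hT

/-- **`SchanuelTwoOnPeriodLattices` — PROVED** (item `stmt-Schanuel-14661`): for every lattice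
basis `(ω₁, ω₂)` with algebraic invariants `g₂, g₃`, `trdeg_ℚ ℚ(ω₁, ω₂, e^{ω₁}, e^{ω₂}) ≥ 2`
(Schanuel's conjecture in rank `2` at the point `(ω₁, ω₂)`). The conditional closure
`schanuelTwoOnPeriodLattices_of_tubbs` applied to the discharge
`Literature.NumberTheory.Transcendental.Tubbs1990_thm4_periods_holds` (`TubbsPeriodsMain.lean`:
Tubbs 1990 Thm 4 = Chudnovsky 1984, Ch. 7 Thm 4.1 (i), proved in the tree by Gel'fond's method).
[cite: Tubbs1990, Thm 4 p. 112 and Remark p. 114] [cite: Chudnovsky1984, Ch. 7 Thm 4.1 (i) p. 318] -/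
theorem schanuelTwoOnPeriodLattices_proof :
    Summit.Schanuel.Schanuel.Theses.RoyCriterion.SchanuelTwoOnPeriodLattices :=
  schanuelTwoOnPeriodLattices_of_tubbs
    Literature.NumberTheory.Transcendental.Tubbs1990_thm4_periods_holds

end Summit.Schanuel.Schanuel.Theorems.RoyCriterion

end
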